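import Summits.QuantumAdvantage.QuantumAdvantage.Theses.SosSandwich
import Literature.Computability.QuantumComplexity.InfluenceBounds

/-!
# Route `SosSandwich`, support `HomogeneousPBAA` (stmt-QuantumAdvantage-15241; stub `stub_homogeneousRung` of
crux `PseudoBoundedAA`, stmt-QuantumAdvantage-15237) — the Laplacian eigen-equation fixes the TOTAL influence

The homogeneity antecedent of `HomogeneousPBAA` is the Laplacian eigen-equation
`Σᵢ (p(x) − p(xⁱ)) = 4T·(p(x) − E p)` at every point of the cube (`p − E p` on Fourier level exactly `2T`).
Multiplying by `p(x)` and averaging gives, with NO use of pseudo-boundedness and no Fourier analysis, the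
exact total-influence identity

  `Σᵢ Infᵢ[p] = 8T · Var[p]`   (tree influence `Infᵢ = E (p − p∘flipᵢ)²`, plain variance),

because `E (p − p∘flipᵢ)² = 2·E[p·(p − p∘flipᵢ)]` (flip invariance of the cube average). Hence some variable
has `Infᵢ[p] ≥ 8T·Var[p]/N`, and the conclusion `C·Var[p]² ≤ Infᵢ[p]` of `HomogeneousPBAA` holds OUTRIGHT in
the incoherent regime `N·Var[p] ≤ 8T/C`. What the stub still asks for is therefore exactly the coherent regime
`Var[p] ≫ T/N` (many variables, each of influence `≈ 8T·Var/N`, variance far above `T/N`), where the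
`T`-uniform bound `maxᵢ Infᵢ ≥ C·Var²` is known on the Fourier-completely-bounded ball (Escudero Gutiérrez,
arXiv:2304.06713, Thm. 1.6) and open on the SOS sandwich class `K_T`.

* `sum_sq_sub_flipBit` — `Σₓ (f x − f xⁱ)² = 2 Σₓ f x (f x − f xⁱ)`;
* `sum_influence_eq_of_laplacian` — the identity `Σᵢ Infᵢ[p] = 8T·Var[p]`;
* `exists_influence_ge_of_laplacian` — `∃ i, 8T·Var[p]/N ≤ Infᵢ[p]` (for `Var[p] > 0`);
* `exists_influence_ge_sq_of_laplacian` — `∃ i, C·Var[p]² ≤ Infᵢ[p]` whenever `N·Var[p] ≤ 8T/C`;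
* `homogeneousRung_incoherent` — the same in the literal inline vocabulary of the route file / the registered
  skeleton `Cruxes/PseudoBoundedAA/Lines/birth.lean` (`ev`, `avg`, `Function.update x i (!x i)`).

All proved, no named fact. [cite: ODonnell2014, §2.2–§2.3 (total influence, Laplacian)] [cite: EscuderoGutierrez2023, Thm. 1.6]
-/

set_option linter.dupNamespace false -- D-0017: single-problem summit ⇒ `QuantumAdvantage.QuantumAdvantage` by design

namespace Summit.QuantumAdvantage.QuantumAdvantage.Theorems.SosSandwich

open Finset Literature.Computability.QuantumComplexity

variable {N : ℕ}

/-- Flip invariance doubles the square: `Σₓ (f(x) − f(xⁱ))² = 2·Σₓ f(x)·(f(x) − f(xⁱ))`.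
[cite: ODonnell2014, §2.2] -/
theorem sum_sq_sub_flipBit (i : Fin N) (f : (Fin N → Bool) → ℝ) :
    ∑ x, (f x - f (flipBit i x)) ^ 2 = 2 * ∑ x, f x * (f x - f (flipBit i x)) := by
  have h := sum_flipBit i (fun x => f x * (f x - f (flipBit i x)))
  simp only [flipBit_flipBit] at h
  have hpt : ∀ x, (f x - f (flipBit i x)) ^ 2 =
      f x * (f x - f (flipBit i x)) + f (flipBit i x) * (f (flipBit i x) - f x) := fun x => by ring
  simp_rw [hpt]
  rw [Finset.sum_add_distrib, h]
  ring

/-- **Total influence under the Laplacian eigen-equation.** If `Σᵢ (p(x) − p(xⁱ)) = 4T·(p(x) − E p)` at every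
point of the cube (the homogeneity antecedent of `HomogeneousPBAA`: `p − E p` on Fourier level exactly `2T`),
then `Σᵢ Infᵢ[p] = 8T·Var[p]`. [cite: ODonnell2014, §2.3 (Laplacian, total influence)] -/
theorem sum_influence_eq_of_laplacian (T : ℕ) (p : MvPolynomial (Fin N) ℝ)
    (hH : ∀ x : Fin N → Bool, ∑ i, (evalBool p x - evalBool p (flipBit i x)) =
      4 * (T : ℝ) * (evalBool p x - boolAvg (evalBool p))) :
    ∑ i, influence i p = 8 * (T : ℝ) * boolVariance p := by
  set f : (Fin N → Bool) → ℝ := evalBool p with hf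
  set m : ℝ := boolAvg f with hm
  -- `Σₓ (f x − m) = 0`
  have hcenter : ∑ x : Fin N → Bool, (f x - m) = 0 := by
    rw [Finset.sum_sub_distrib, Finset.sum_const, Finset.card_univ, nsmul_eq_mul]
    have hcard : ((Fintype.card (Fin N → Bool) : ℕ) : ℝ) = (2 : ℝ) ^ N := by
      simp [Fintype.card_bool, Fintype.card_fin]
    rw [hcard, hm]
    unfold boolAvg
    field_simp
    ring
  -- the influences, summed
  have hinf : ∀ i, influence i p = (2 * ∑ x, f x * (f x - f (flipBit i x))) / (2 : ℝ) ^ N := by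
    intro i
    unfold influence boolAvg
    rw [sum_sq_sub_flipBit]
  calc ∑ i, influence i p
      = ∑ i, (2 * ∑ x, f x * (f x - f (flipBit i x))) / (2 : ℝ) ^ N := Finset.sum_congr rfl fun i _ => hinf i
    _ = (2 * ∑ x, f x * ∑ i, (f x - f (flipBit i x))) / (2 : ℝ) ^ N := by
        rw [← Finset.sum_div, ← Finset.mul_sum, Finset.sum_comm]
        congr 2
        exact Finset.sum_congr rfl fun x _ => by rw [Finset.mul_sum]
    _ = (2 * ∑ x, f x * (4 * (T : ℝ) * (f x - m))) / (2 : ℝ) ^ N := by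
        congr 2
        exact Finset.sum_congr rfl fun x _ => by rw [hH x]
    _ = 8 * (T : ℝ) * ((∑ x, (f x - m) ^ 2) / (2 : ℝ) ^ N) := by
        have hsq : ∑ x : Fin N → Bool, (f x - m) ^ 2 = ∑ x, f x * (f x - m) := by
          have h' : ∑ x : Fin N → Bool, (f x - m) ^ 2 =
              ∑ x, f x * (f x - m) - m * ∑ x, (f x - m) := by
            rw [Finset.mul_sum, ← Finset.sum_sub_distrib]
            exact Finset.sum_congr rfl fun x _ => by ring
          rw [h', hcenter, mul_zero, sub_zero]
        have key : 2 * ∑ x : Fin N → Bool, f x * (4 * (T : ℝ) * (f x - m)) =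
            8 * (T : ℝ) * ∑ x, f x * (f x - m) := by
          rw [Finset.mul_sum, Finset.mul_sum]
          exact Finset.sum_congr rfl fun x _ => by ring
        rw [hsq, key, mul_div_assoc]
    _ = 8 * (T : ℝ) * boolVariance p := by rfl

/-- Averaging: under the Laplacian eigen-equation some variable has `Infᵢ[p] ≥ 8T·Var[p]/N`
(`Var[p] > 0` forces `N ≥ 1`). [cite: ODonnell2014, §2.3] -/
theorem exists_influence_ge_of_laplacian (T : ℕ) (p : MvPolynomial (Fin N) ℝ)
    (hH : ∀ x : Fin N → Bool, ∑ i, (evalBool p x - evalBool p (flipBit i x)) =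
      4 * (T : ℝ) * (evalBool p x - boolAvg (evalBool p)))
    (hv : 0 < boolVariance p) :
    ∃ i : Fin N, 8 * (T : ℝ) * boolVariance p / N ≤ influence i p := by
  have hsum := sum_influence_eq_of_laplacian T p hH
  -- `N ≥ 1`: on the empty cube the variance vanishes
  have hN : 0 < N := by
    rcases Nat.eq_zero_or_pos N with h0 | hpos
    · exfalso
      subst h0
      have : boolVariance p = 0 := by
        unfold boolVariance boolAvg
        simp
      exact hv.ne' this
    · exact hpos
  -- some term is at least the average
  by_contra hcon
  push Not at hcon
  have hlt : ∑ i : Fin N, influence i p < ∑ _i : Fin N, 8 * (T : ℝ) * boolVariance p / N :=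
    Finset.sum_lt_sum_of_nonempty (Finset.univ_nonempty_iff.mpr ⟨⟨0, hN⟩⟩) fun i _ => hcon i
  rw [Finset.sum_const, Finset.card_univ, Fintype.card_fin, nsmul_eq_mul, hsum] at hlt
  have hNr : (0 : ℝ) < N := Nat.cast_pos.mpr hN
  have : (N : ℝ) * (8 * (T : ℝ) * boolVariance p / N) = 8 * (T : ℝ) * boolVariance p := by
    field_simp
  linarith [this]

/-- **The incoherent regime of the homogeneous rung.** Under the Laplacian eigen-equation, the conclusion
`C·Var[p]² ≤ Infᵢ[p]` of `HomogeneousPBAA` holds for SOME `i` as soon as `N·Var[p] ≤ 8T/C` — with no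
pseudo-boundedness and no bound on `C`. The stub `stub_homogeneousRung` is thus open exactly in the coherent
regime `Var[p] > 8T/(C·N)`. [cite: EscuderoGutierrez2023, Thm. 1.6] [cite: ODonnell2014, §2.3] -/
theorem exists_influence_ge_sq_of_laplacian (T : ℕ) (p : MvPolynomial (Fin N) ℝ) {C : ℝ} (hC : 0 < C)
    (hH : ∀ x : Fin N → Bool, ∑ i, (evalBool p x - evalBool p (flipBit i x)) =
      4 * (T : ℝ) * (evalBool p x - boolAvg (evalBool p)))
    (hv : 0 < boolVariance p) (hreg : (N : ℝ) * boolVariance p ≤ 8 * (T : ℝ) / C) :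
    ∃ i : Fin N, C * boolVariance p ^ 2 ≤ influence i p := by
  obtain ⟨i, hi⟩ := exists_influence_ge_of_laplacian T p hH hv
  refine ⟨i, le_trans ?_ hi⟩
  have hN : (0 : ℝ) < N := by
    rcases (Nat.cast_nonneg N : (0 : ℝ) ≤ N).eq_or_lt with h0 | hpos
    · exfalso
      -- `N = 0` forces `Var[p] = 0`
      have hN0 : N = 0 := by exact_mod_cast h0.symm
      subst hN0
      have : boolVariance p = 0 := by
        unfold boolVariance boolAvg
        simp
      exact hv.ne' this
    · exact hpos
  -- `C·Var² ≤ 8T·Var/N  ⟸  C·N·Var ≤ 8T`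
  rw [le_div_iff₀ hN]
  have h1 : C * ((N : ℝ) * boolVariance p) ≤ 8 * (T : ℝ) := by
    have := mul_le_mul_of_nonneg_left hreg hC.le
    rwa [mul_div_assoc', mul_div_cancel_left₀ _ hC.ne'] at this
  nlinarith [hv, h1]

/-- **Inline form** (the literal vocabulary of the route file `Theses/SosSandwich.lean` and of the registered
skeleton `Cruxes/PseudoBoundedAA/Lines/birth.lean`: `ev`, `avg`, `xⁱ = Function.update x i (!x i)`, which are
definitionally `evalBool`, `boolAvg`, `flipBit`): from `TopHomogeneous T p`, `0 < cvar p` and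
`N·cvar p ≤ 8T/C` conclude `∃ i, C·(cvar p)² ≤ infl p i`. [cite: EscuderoGutierrez2023, Thm. 1.6] -/
theorem homogeneousRung_incoherent (N T : ℕ) (p : MvPolynomial (Fin N) ℝ) {C : ℝ} (hC : 0 < C) :
    let ev : MvPolynomial (Fin N) ℝ → (Fin N → Bool) → ℝ :=
      fun f x => MvPolynomial.eval (fun k => if x k then (1 : ℝ) else 0) f
    let avg : ((Fin N → Bool) → ℝ) → ℝ := fun g => (∑ x : Fin N → Bool, g x) / (2 : ℝ) ^ N
    (∀ x : Fin N → Bool, ∑ i : Fin N, (ev p x - ev p (Function.update x i (!x i))) =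
        4 * (T : ℝ) * (ev p x - avg (ev p))) →
      0 < (avg fun x => (ev p x - avg (ev p)) ^ 2) →
      (N : ℝ) * (avg fun x => (ev p x - avg (ev p)) ^ 2) ≤ 8 * (T : ℝ) / C →
      ∃ i : Fin N, C * (avg fun x => (ev p x - avg (ev p)) ^ 2) ^ 2 ≤
        avg fun x => (ev p x - ev p (Function.update x i (!x i))) ^ 2 := by
  intro ev avg hH hv hreg
  exact exists_influence_ge_sq_of_laplacian T p hC hH hv hreg


/-- **The homogeneous rung is its coherent half.** The route item `HomogeneousPBAA` (stmt-QuantumAdvantage-15241 =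
stub `stub_homogeneousRung` of crux `PseudoBoundedAA`) is EQUIVALENT to its restriction to the coherent regime
`8T/C < N·Var[p]`: instances with `N·Var[p] ≤ 8T/C` are discharged by `homogeneousRung_incoherent` with the same
constant. So a proof (or a refuting family) of the stub may assume many variables, each of influence `≈ 8T·Var/N`,
and variance far above `T/N`. [cite: EscuderoGutierrez2023, Thm. 1.6] [cite: ODonnell2014, §2.3] -/
theorem homogeneousPBAA_iff_coherent :
    Summit.QuantumAdvantage.QuantumAdvantage.Theses.SosSandwich.HomogeneousPBAA ↔
      ∃ C : ℝ, 0 < C ∧ ∀ (N T : ℕ) (p : MvPolynomial (Fin N) ℝ),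
        let ev : MvPolynomial (Fin N) ℝ → (Fin N → Bool) → ℝ :=
          fun f x => MvPolynomial.eval (fun k => if x k then (1 : ℝ) else 0) f
        let avg : ((Fin N → Bool) → ℝ) → ℝ := fun g => (∑ x : Fin N → Bool, g x) / (2 : ℝ) ^ N
        1 ≤ T →
        (∃ (m : ℕ) (q r : Fin m → MvPolynomial (Fin N) ℝ),
            (∀ j, (q j).totalDegree ≤ T ∧ (r j).totalDegree ≤ T) ∧
              ∀ x : Fin N → Bool, ev p x = ∑ j, ev (q j) x ^ 2 ∧ 1 - ev p x = ∑ j, ev (r j) x ^ 2) →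
        (∀ x : Fin N → Bool, ∑ i : Fin N, (ev p x - ev p (Function.update x i (!x i))) =
            4 * (T : ℝ) * (ev p x - avg (ev p))) →
        0 < (avg fun x => (ev p x - avg (ev p)) ^ 2) →
        8 * (T : ℝ) / C < (N : ℝ) * (avg fun x => (ev p x - avg (ev p)) ^ 2) →
        ∃ i : Fin N, C * (avg fun x => (ev p x - avg (ev p)) ^ 2) ^ 2 ≤
          (avg fun x => (ev p x - ev p (Function.update x i (!x i))) ^ 2) := by
  constructor
  · rintro ⟨C, hC, h⟩
    exact ⟨C, hC, fun N T p hT hpb hH hv _ => h N T p hT hpb hH hv⟩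
  · rintro ⟨C, hC, h⟩
    refine ⟨C, hC, fun N T p hT hpb hH hv => ?_⟩
    by_cases hreg : 8 * (T : ℝ) / C < (N : ℝ) * ((∑ x : Fin N → Bool,
        (MvPolynomial.eval (fun k => if x k then (1 : ℝ) else 0) p -
          (∑ x : Fin N → Bool, MvPolynomial.eval (fun k => if x k then (1 : ℝ) else 0) p) / (2 : ℝ) ^ N) ^ 2) /
        (2 : ℝ) ^ N)
    · exact h N T p hT hpb hH hv hreg
    · exact homogeneousRung_incoherent N T p hC hH hv (le_of_not_gt hreg)

end Summit.QuantumAdvantage.QuantumAdvantage.Theorems.SosSandwich
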